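import Summits.QuantumFields.BalabanUV.Beta.GAN24.TaylorBlockSum

/-!
# `BalabanUV.Beta.GAN24.TaylorVHSandwich` — G-an2-4 / (CONV-C), S-slot, road «S3-Taylor» (`SKELETON-S3.md` §12.2∕§16): THE GENERIC ROW-FORM
# TWO-CHANNEL UNIT-SANDWICH BOUND behind the (V-H) SHAPE rows Vt ∕ V ∕ V0 — ENGINE OF RECORD by the row owner's RULINGS-9 (journal l.4834)

NOT IN PRINT; OUR BOOKKEEPING (leaf seat `b2b-balaban-gan24-formalise-leaf-12`, gen 17, ROW-Vt holder; journal l.4637 ∕ l.4817).  HONEST FRAMING (cell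
contract, verbatim): «discharging `BetaPertH` makes Bałaban's UV stability UNCONDITIONAL — a real constructive-QFT result; it is NOT the continuum limit
and NOT the Clay problem.»  HONEST DEPENDENCY (verbatim): «continuum YM on T⁴ ⇐ BetaPertH ∧ nine spine estimates (0/9 proved); BetaPertH ⇐ (D1) ∧ (D4) ∧
CAP+tail; G-an2-4 gates asym, D1 and NE2/3/4.»  [folklore] real analysis on `ℤ^D` over leaf-04's `TaylorBlockSum` BY NAME: cites nothing, mints no `def`,
no `def … : Prop`; legs and table are ABSTRACT functions.  Discharges NOTHING of rows Vt∕V∕V0, «E3Shape», (hS, hSall); NOT BetaPertH, NOT continuum, NOT Clay.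

`E3UnitSplitLevels.e3VH_unit_split_of` writes the normalised third jet of an off-diagonal stencil family as a prefactor times a TWO-CHANNEL UNIT SANDWICH
(legs `Φ̃ = N^{2(d+1)}·(KInv_N)_{mm}`, `H̃ = N^{d+2}·wH_N`, `G̃ = −H̃ᵀ`; vertex location block-averaged `N^{−D}Σ'_u`).  Here the legs are abstract with
block-exponential bounds from the coarse points `x′, u′, z′`, the table abstract with an `ℓ¹`-SUPPORT radius `R` around the vertex location and a two-leg
ROW mass `≤ mP` over any finite sets (VH1's currency); the bound is `2·(#ι)³·A³·e^{κ(4DR/N + 2D)}·mP·Zl_D(κ/2)·e^{−(κ/2)(|x′−u′|₁ + |z′−u′|₁)}`.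
PROOF: u OUTERMOST without Fubini on `tsum`s — the two inner `tsum`s are finite cube sums in the offsets `s = w − y`, `t = u − w` (§1), domination
`|Σ'_y Σ_fin| ≤ Σ_fin Σ'_y |·|`, the shift `y ↦ u = y + s + t`, leg transfer to `quo_N u` (`TaylorBlockSum.exp_quo_transfer`), the finite∕`tsum` swap back,
the joint `(s,t)`-sum of `|P|` as an injective image inside `S × T` (≤ `mP`), and W4 `blockSum_exp_le` at the vertex block (§3 `channel_bound`, §4).
(The COLUMN form — outer `y`-sum as a fine block average — loses `N^D` on the channel whose outer leg is the coarse multiplier site; journal l.4817∕l.4834.)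
-/

noncomputable section

open Finset
open scoped BigOperators
open Literature.MathematicalPhysics.QuantumFieldTheory Literature.MathematicalPhysics.QuantumFieldTheory.Balaban1983to89
open Literature.MathematicalPhysics.QuantumFieldTheory.Balaban1983to89.Beta
open B12Sec2to5 (l1 l1_nonneg)
open ExpKernelCalculus (Zl Zl_pos summable_exp_shift' l1_sub_triangle l1_sub_symm)
open LatticeForm (quo)
open Summit.QuantumFields.BalabanUV.Beta.GAN24.TaylorBlockSum (exp_quo_transfer blockSum_exp_le summable_blockSum_exp summable_comp_quo)

namespace Summit.QuantumFields.BalabanUV.Beta.GAN24.TaylorVHSandwich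

variable {D : ℕ}

/-! ## §1 Finite-support bookkeeping on `ℤ^D` -/
/-- [folklore] A coordinate is at most the `ℓ¹` norm. -/
theorem abs_coord_le_l1 (v : Fin D → ℤ) (i : Fin D) : |((v i : ℤ) : ℝ)| ≤ l1 v :=
  Finset.single_le_sum (f := fun μ => |((v μ : ℤ) : ℝ)|) (fun _ _ => abs_nonneg _) (Finset.mem_univ i)
/-- [folklore] The `ℓ¹`-ball of radius `R` lies in the origin cube of half-width `R`. -/
theorem mem_cube_of_l1_le {R : ℕ} {v : Fin D → ℤ} (h : l1 v ≤ R) :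
    v ∈ Fintype.piFinset (fun _ : Fin D => Finset.Icc (-(R : ℤ)) (R : ℤ)) := by
  rw [Fintype.mem_piFinset]; intro i; rw [Finset.mem_Icc]
  have hi : |((v i : ℤ) : ℝ)| ≤ R := (abs_coord_le_l1 v i).trans h
  rw [← Int.cast_abs] at hi
  have hi' : |v i| ≤ (R : ℤ) := by exact_mod_cast hi
  exact ⟨(abs_le.mp hi').1, (abs_le.mp hi').2⟩
/-- [folklore] A point of the origin cube of half-width `R` has `ℓ¹` norm at most `D·R`. -/
theorem l1_le_of_mem_cube {R : ℕ} {v : Fin D → ℤ} (h : v ∈ Fintype.piFinset (fun _ : Fin D => Finset.Icc (-(R : ℤ)) (R : ℤ))) :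
    l1 v ≤ D * R := by
  rw [Fintype.mem_piFinset] at h
  calc l1 v = ∑ i, |((v i : ℤ) : ℝ)| := rfl
    _ ≤ ∑ _i : Fin D, (R : ℝ) := Finset.sum_le_sum fun i _ => by
        have hi := Finset.mem_Icc.mp (h i)
        rw [← Int.cast_abs]
        exact_mod_cast abs_le.mpr ⟨hi.1, hi.2⟩
    _ = D * R := by simp
/-- [folklore] **SUPPORT REDUCTION**: a function vanishing outside the `ℓ¹`-ball of radius `R` around `w` has
`Σ'_u f u = Σ_{t ∈ cube R} f (w + t)`. -/
theorem tsum_eq_sum_cube {R : ℕ} {f : (Fin D → ℤ) → ℝ} (w : Fin D → ℤ) (hf : ∀ u, f u ≠ 0 → l1 (u - w) ≤ R) :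
    ∑' u, f u = ∑ t ∈ Fintype.piFinset (fun _ : Fin D => Finset.Icc (-(R : ℤ)) (R : ℤ)), f (w + t) := by
  classical
  rw [← Finset.sum_image (f := f) (g := fun t => w + t) (fun t _ t' _ h => add_left_cancel h)]
  refine tsum_eq_sum fun u hu => ?_
  by_contra hne
  exact hu (Finset.mem_image.mpr ⟨u - w, mem_cube_of_l1_le (hf u hne), by abel⟩)
/-- [folklore] A finite sum vanishes outside the `ℓ¹`-ball if every summand does. -/
theorem sum_support {ι : Type*} (s : Finset ι) {g : ι → (Fin D → ℤ) → ℝ} {w : Fin D → ℤ} {R : ℝ}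
    (hg : ∀ i ∈ s, ∀ u, g i u ≠ 0 → l1 (u - w) ≤ R) (u : Fin D → ℤ) (hu : ∑ i ∈ s, g i u ≠ 0) : l1 (u - w) ≤ R := by
  obtain ⟨i, hi, hne⟩ := Finset.exists_ne_zero_of_sum_ne_zero hu
  exact hg i hi u hne

/-! ## §2 Domination and leg bookkeeping -/
/-- [folklore] Domination: `|f i| ≤ g i` with `g` summable ⟹ `|Σ' f| ≤ Σ' g` (no summability of `f` assumed). -/
theorem abs_tsum_le_of_le {ι : Type*} {f g : ι → ℝ} (hg : Summable g) (h : ∀ i, |f i| ≤ g i) : |∑' i, f i| ≤ ∑' i, g i := by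
  have := tsum_of_norm_bounded hg.hasSum (fun i => by rw [Real.norm_eq_abs]; exact h i); rwa [Real.norm_eq_abs] at this
/-- [folklore] Domination gives summability. -/
theorem summable_of_abs_le {ι : Type*} {f g : ι → ℝ} (hg : Summable g) (h : ∀ i, |f i| ≤ g i) : Summable f :=
  Summable.of_norm_bounded hg (fun i => by rw [Real.norm_eq_abs]; exact h i)
/-- [folklore] A single block-decaying leg is summable over the fine lattice. -/
theorem summable_leg {N : ℕ} [NeZero N] {κ : ℝ} (hκ : 0 < κ) (p : Fin D → ℤ) :
    Summable (fun y : Fin D → ℤ => Real.exp (-κ * l1 (quo N y - p))) :=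
  summable_comp_quo (N := N) (g := fun q => Real.exp (-κ * l1 (q - p))) (summable_exp_shift' hκ p)
/-- [folklore] Pointwise size of a table from its two-leg mass (singletons). -/
theorem abs_le_of_mass {ι : Type*} {Q : ι → (Fin D → ℤ) → (Fin D → ℤ) → (Fin D → ℤ) → ι → ι → ℝ} {mP : ℝ}
    (hM : ∀ k u l l' (S T : Finset (Fin D → ℤ)), ∑ w ∈ S, ∑ y ∈ T, |Q k u w y l l'| ≤ mP)
    (k : ι) (u w y : Fin D → ℤ) (l l' : ι) : |Q k u w y l l'| ≤ mP := by
  simpa only [Finset.sum_singleton] using hM k u l l' {w} {y}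
/-- [folklore] Five-fold exchange of a `tsum` with finite sums (termwise summability). -/
theorem tsum_sum₅ {α β γ δ ε X : Type*} (s₁ : Finset α) (s₂ : Finset β) (s₃ : Finset γ) (s₄ : Finset δ) (s₅ : Finset ε)
    {f : α → β → γ → δ → ε → X → ℝ} (h : ∀ a ∈ s₁, ∀ b ∈ s₂, ∀ c ∈ s₃, ∀ d ∈ s₄, ∀ e ∈ s₅, Summable (f a b c d e)) :
    ∑' x, ∑ a ∈ s₁, ∑ b ∈ s₂, ∑ c ∈ s₃, ∑ d ∈ s₄, ∑ e ∈ s₅, f a b c d e x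
      = ∑ a ∈ s₁, ∑ b ∈ s₂, ∑ c ∈ s₃, ∑ d ∈ s₄, ∑ e ∈ s₅, ∑' x, f a b c d e x := by
  rw [Summable.tsum_finsetSum (fun a ha => summable_sum fun b hb => summable_sum fun c hc => summable_sum fun d hd =>
    summable_sum fun e he => h a ha b hb c hc d hd e he)]
  refine Finset.sum_congr rfl fun a ha => ?_
  rw [Summable.tsum_finsetSum (fun b hb => summable_sum fun c hc => summable_sum fun d hd => summable_sum fun e he =>
    h a ha b hb c hc d hd e he)]
  refine Finset.sum_congr rfl fun b hb => ?_
  rw [Summable.tsum_finsetSum (fun c hc => summable_sum fun d hd => summable_sum fun e he => h a ha b hb c hc d hd e he)]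
  refine Finset.sum_congr rfl fun c hc => ?_
  rw [Summable.tsum_finsetSum (fun d hd => summable_sum fun e he => h a ha b hb c hc d hd e he)]
  refine Finset.sum_congr rfl fun d hd => ?_
  rw [Summable.tsum_finsetSum (fun e he => h a ha b hb c hc d hd e he)]
/-- [folklore] `|s + t|₁ ≤ |s|₁ + |t|₁`. -/
theorem l1_add_le (s t : Fin D → ℤ) : l1 (s + t) ≤ l1 s + l1 t := by
  simpa only [sub_zero, add_sub_cancel_right] using l1_sub_triangle (s + t) t 0
/-- [folklore] `|−t|₁ = |t|₁` in the form `|(u − t) − u|₁ = |t|₁`. -/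
theorem l1_sub_sub_self (u t : Fin D → ℤ) : l1 (u - t - u) = l1 t := by
  rw [l1_sub_symm, show u - (u - t) = t by abel]

/-! ## §3 One channel of the unit sandwich -/
/-- **ONE CHANNEL OF THE TWO-CHANNEL UNIT SANDWICH** (abstract legs `Lg`, `H`, `Rg` block-decaying from the coarse points `x′`, `u′`, `z′`;
abstract table `Q k u w y l l′` with `ℓ¹`-support radius `R` around the vertex location `u` and two-leg mass `≤ mP` over any finite sets):
the `y`-family is summable and `|Σ'_y Σ_{l′} (Σ'_w Σ_l Lg w l · Σ_k N^{−D} Σ'_u H k u · Q k u w y l l′) · Rg y l′|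
≤ (#ι)³ · A³ · e^{κ(4DR/N + 2D)} · mP · Zl_D(κ/2) · e^{−(κ/2)(|x′−u′|₁ + |z′−u′|₁)}`. [folklore] -/
theorem channel_bound {N : ℕ} [NeZero N] {ι : Type*} [Fintype ι]
    (Lg : (Fin D → ℤ) → ι → ℝ) (H : ι → (Fin D → ℤ) → ℝ) (Rg : (Fin D → ℤ) → ι → ℝ)
    (Q : ι → (Fin D → ℤ) → (Fin D → ℤ) → (Fin D → ℤ) → ι → ι → ℝ)
    {x' u' z' : Fin D → ℤ} {A κ mP : ℝ} {R : ℕ} (hκ : 0 < κ) (hA : 0 ≤ A) (hmP : 0 ≤ mP)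
    (hLg : ∀ w l, |Lg w l| ≤ A * Real.exp (-κ * l1 (quo N w - x')))
    (hH : ∀ k u, |H k u| ≤ A * Real.exp (-κ * l1 (quo N u - u')))
    (hRg : ∀ y l, |Rg y l| ≤ A * Real.exp (-κ * l1 (quo N y - z')))
    (hS : ∀ k u w y l l', Q k u w y l l' ≠ 0 → l1 (w - u) ≤ R ∧ l1 (y - u) ≤ R)
    (hM : ∀ k u l l' (S T : Finset (Fin D → ℤ)), ∑ w ∈ S, ∑ y ∈ T, |Q k u w y l l'| ≤ mP) :
    Summable (fun y => ∑ l', (∑' w, ∑ l, Lg w l * ∑ k, ((N : ℝ) ^ D)⁻¹ * ∑' u, H k u * Q k u w y l l') * Rg y l') ∧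
    |∑' y, ∑ l', (∑' w, ∑ l, Lg w l * ∑ k, ((N : ℝ) ^ D)⁻¹ * ∑' u, H k u * Q k u w y l l') * Rg y l'|
      ≤ (Fintype.card ι : ℝ) ^ 3 * A ^ 3 * Real.exp (κ * (4 * D * R / N + 2 * D)) * mP * Zl D (κ / 2)
          * Real.exp (-(κ / 2) * (l1 (x' - u') + l1 (z' - u'))) := by
  classical
  set c : ℝ := ((N : ℝ) ^ D)⁻¹ with hc
  set CR : Finset (Fin D → ℤ) := Fintype.piFinset (fun _ : Fin D => Finset.Icc (-(R : ℤ)) (R : ℤ)) with hCR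
  set C2 : Finset (Fin D → ℤ) := Fintype.piFinset (fun _ : Fin D => Finset.Icc (-((2 * R : ℕ) : ℤ)) ((2 * R : ℕ) : ℤ))
    with hC2
  set C3 : Finset (Fin D → ℤ) := Fintype.piFinset (fun _ : Fin D => Finset.Icc (-((3 * R : ℕ) : ℤ)) ((3 * R : ℕ) : ℤ))
    with hC3
  have hNpos : (0 : ℝ) < N := by exact_mod_cast Nat.pos_of_ne_zero (NeZero.ne N)
  have hc0 : 0 ≤ c := by positivity
  set E3 : (Fin D → ℤ) → ℝ := fun u =>
    Real.exp (-κ * (l1 (quo N u - x') + l1 (quo N u - u') + l1 (quo N u - z'))) with hE3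
  set K₀ : ℝ := A ^ 3 * Real.exp (κ * (4 * D * R / N + 2 * D)) with hK₀
  have hK₀0 : 0 ≤ K₀ := by positivity
  have hQle : ∀ k u w y l l', |Q k u w y l l'| ≤ mP := abs_le_of_mass hM
  -- STEP 1: support reductions (inner `u`-sum around `w`, middle `w`-sum around `y`)
  have inner : ∀ k w y l l', ∑' u, H k u * Q k u w y l l' = ∑ t ∈ CR, H k (w + t) * Q k (w + t) w y l l' := by
    intro k w y l l'
    refine tsum_eq_sum_cube w (fun u hu => ?_)
    have hQ : Q k u w y l l' ≠ 0 := fun h0 => hu (by rw [h0, mul_zero])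
    have h1 := (hS k u w y l l' hQ).1
    rwa [l1_sub_symm] at h1
  have mid : ∀ y l', (∑' w, ∑ l, Lg w l * ∑ k, c * ∑' u, H k u * Q k u w y l l')
      = ∑ s ∈ C2, ∑ l, Lg (y + s) l * ∑ k, c * ∑ t ∈ CR, H k (y + s + t) * Q k (y + s + t) (y + s) y l l' := by
    intro y l'
    have hsupp : ∀ w, (∑ l, Lg w l * ∑ k, c * ∑' u, H k u * Q k u w y l l') ≠ 0 → l1 (w - y) ≤ ((2 * R : ℕ) : ℝ) := by
      intro w hw
      by_contra hfar
      apply hw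
      refine Finset.sum_eq_zero fun l _ => ?_
      have hz : ∀ k, ∑' u, H k u * Q k u w y l l' = 0 := by
        intro k
        have h0 : ∀ u, Q k u w y l l' = 0 := by
          intro u
          by_contra hQ
          obtain ⟨h1, h2⟩ := hS k u w y l l' hQ
          apply hfar
          rw [l1_sub_symm] at h2
          calc l1 (w - y) ≤ l1 (w - u) + l1 (u - y) := l1_sub_triangle w u y
            _ ≤ R + R := add_le_add h1 h2
            _ = ((2 * R : ℕ) : ℝ) := by push_cast; ring
        simp only [h0, mul_zero, tsum_zero]
      simp only [hz, mul_zero, Finset.sum_const_zero]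
    rw [tsum_eq_sum_cube (R := 2 * R) y hsupp]
    refine Finset.sum_congr rfl fun s _ => Finset.sum_congr rfl fun l _ => ?_
    congr 1
    refine Finset.sum_congr rfl fun k _ => ?_
    rw [inner]
  -- the flat majorant term
  set T : ι → ι → ι → (Fin D → ℤ) → (Fin D → ℤ) → (Fin D → ℤ) → ℝ :=
    fun l' l k s t y => |Lg (y + s) l| * (c * (|H k (y + s + t)| * |Q k (y + s + t) (y + s) y l l'|)) * |Rg y l'| with hT
  have hT0 : ∀ l' l k s t y, 0 ≤ T l' l k s t y := fun l' l k s t y => by rw [hT]; positivity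
  -- STEP 2: pointwise majorant
  have hpt : ∀ y, |∑ l', (∑' w, ∑ l, Lg w l * ∑ k, c * ∑' u, H k u * Q k u w y l l') * Rg y l'|
      ≤ ∑ l', ∑ l, ∑ k, ∑ s ∈ C2, ∑ t ∈ CR, T l' l k s t y := by
    intro y
    rw [show (∑ l', (∑' w, ∑ l, Lg w l * ∑ k, c * ∑' u, H k u * Q k u w y l l') * Rg y l')
        = ∑ l', (∑ s ∈ C2, ∑ l, Lg (y + s) l * ∑ k, c * ∑ t ∈ CR, H k (y + s + t) * Q k (y + s + t) (y + s) y l l') * Rg y l'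
        from Finset.sum_congr rfl fun l' _ => by rw [mid y l']]
    calc |∑ l', (∑ s ∈ C2, ∑ l, Lg (y + s) l * ∑ k, c * ∑ t ∈ CR, H k (y + s + t) * Q k (y + s + t) (y + s) y l l') * Rg y l'|
        ≤ ∑ l', |(∑ s ∈ C2, ∑ l, Lg (y + s) l * ∑ k, c * ∑ t ∈ CR, H k (y + s + t) * Q k (y + s + t) (y + s) y l l')
            * Rg y l'| := Finset.abs_sum_le_sum_abs _ _
      _ ≤ ∑ l', (∑ s ∈ C2, ∑ l, |Lg (y + s) l| * ∑ k, c * ∑ t ∈ CR, |H k (y + s + t)| * |Q k (y + s + t) (y + s) y l l'|)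
            * |Rg y l'| := by
          refine Finset.sum_le_sum fun l' _ => ?_
          rw [abs_mul]
          refine mul_le_mul_of_nonneg_right ?_ (abs_nonneg _)
          refine (Finset.abs_sum_le_sum_abs _ _).trans (Finset.sum_le_sum fun s _ => ?_)
          refine (Finset.abs_sum_le_sum_abs _ _).trans (Finset.sum_le_sum fun l _ => ?_)
          rw [abs_mul]
          refine mul_le_mul_of_nonneg_left ?_ (abs_nonneg _)
          refine (Finset.abs_sum_le_sum_abs _ _).trans (Finset.sum_le_sum fun k _ => ?_)
          rw [abs_mul, abs_of_nonneg hc0]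
          refine mul_le_mul_of_nonneg_left ?_ hc0
          refine (Finset.abs_sum_le_sum_abs _ _).trans (Finset.sum_le_sum fun t _ => ?_)
          rw [abs_mul]
      _ = ∑ l', ∑ s ∈ C2, ∑ l, ∑ k, ∑ t ∈ CR, T l' l k s t y := by
          refine Finset.sum_congr rfl fun l' _ => ?_
          simp only [Finset.sum_mul, Finset.mul_sum, hT]
      _ = ∑ l', ∑ l, ∑ k, ∑ s ∈ C2, ∑ t ∈ CR, T l' l k s t y := by
          refine Finset.sum_congr rfl fun l' _ => ?_
          rw [Finset.sum_comm]
          exact Finset.sum_congr rfl fun l _ => Finset.sum_comm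
  -- STEP 3: summability of the majorant terms and of the channel
  have hTle : ∀ l' l k s t y, T l' l k s t y ≤ A * (c * (A * mP)) * (A * Real.exp (-κ * l1 (quo N y - z'))) := by
    intro l' l k s t y
    have h1 : |Lg (y + s) l| ≤ A := (hLg _ _).trans (mul_le_of_le_one_right hA (Real.exp_le_one_iff.mpr
      (by nlinarith [l1_nonneg (quo N (y + s) - x'), hκ])))
    have h2 : |H k (y + s + t)| ≤ A := (hH _ _).trans (mul_le_of_le_one_right hA (Real.exp_le_one_iff.mpr
      (by nlinarith [l1_nonneg (quo N (y + s + t) - u'), hκ])))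
    have h3 := hQle k (y + s + t) (y + s) y l l'
    have h4 := hRg y l'
    simp only [hT]
    gcongr
  have hTsum : ∀ l' l k s t, Summable (T l' l k s t) := fun l' l k s t =>
    summable_of_abs_le (((summable_leg (N := N) hκ z').mul_left A).mul_left (A * (c * (A * mP))))
      (fun y => by rw [abs_of_nonneg (hT0 _ _ _ _ _ _)]; exact hTle l' l k s t y)
  have hFsum : Summable (fun y => ∑ l', ∑ l, ∑ k, ∑ s ∈ C2, ∑ t ∈ CR, T l' l k s t y) :=
    summable_sum fun l' _ => summable_sum fun l _ => summable_sum fun k _ => summable_sum fun s _ =>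
      summable_sum fun t _ => hTsum l' l k s t
  have hsumm : Summable (fun y => ∑ l', (∑' w, ∑ l, Lg w l * ∑ k, c * ∑' u, H k u * Q k u w y l l') * Rg y l') :=
    summable_of_abs_le hFsum hpt
  refine ⟨hsumm, ?_⟩
  -- STEP 4: exchange with the finite sums
  have step4 : |∑' y, ∑ l', (∑' w, ∑ l, Lg w l * ∑ k, c * ∑' u, H k u * Q k u w y l l') * Rg y l'|
      ≤ ∑ l', ∑ l, ∑ k, ∑ s ∈ C2, ∑ t ∈ CR, ∑' y, T l' l k s t y := by
    refine (abs_tsum_le_of_le hFsum hpt).trans (le_of_eq ?_)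
    exact tsum_sum₅ _ _ _ _ _ (fun l' _ l _ k _ s _ t _ => hTsum l' l k s t)
  -- STEP 5: per-term shift to the vertex location and leg transfer
  have hCRl1 : ∀ t ∈ CR, l1 t ≤ D * R := fun t ht => l1_le_of_mem_cube ht
  have hC2l1 : ∀ s ∈ C2, l1 s ≤ D * (2 * R : ℕ) := fun s hs => l1_le_of_mem_cube hs
  have step5 : ∀ l' l k, ∀ s ∈ C2, ∀ t ∈ CR,
      ∑' y, T l' l k s t y ≤ ∑' u, K₀ * (c * E3 u) * |Q k u (u - t) (u - (s + t)) l l'| := by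
    intro l' l k s hs t ht
    -- shift `y = u − (s + t)`
    rw [← (Equiv.subRight (s + t)).tsum_eq (T l' l k s t)]
    have hmaj : Summable (fun u => K₀ * (c * E3 u) * mP) :=
      ((summable_blockSum_exp (N := N) hκ x' u' z').mul_left K₀).mul_right mP
    refine (le_abs_self _).trans (abs_tsum_le_of_le (f := fun u => T l' l k s t (Equiv.subRight (s + t) u))
      (g := fun u => K₀ * (c * E3 u) * |Q k u (u - t) (u - (s + t)) l l'|)
      (summable_of_abs_le hmaj (fun u => ?_)) (fun u => ?_))
    · rw [abs_of_nonneg (by positivity)]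
      exact mul_le_mul_of_nonneg_left (hQle _ _ _ _ _ _) (by positivity)
    · rw [abs_of_nonneg (hT0 _ _ _ _ _ _), Equiv.subRight_apply, hT]
      simp only
      rw [show u - (s + t) + s + t = u by abel, show u - (s + t) + s = u - t by abel]
      -- leg transfers
      have hL : |Lg (u - t) l| ≤ A * Real.exp (κ * (D * R / N + D)) * Real.exp (-κ * l1 (quo N u - x')) := by
        refine (hLg (u - t) l).trans ?_
        rw [mul_assoc]
        refine mul_le_mul_of_nonneg_left ((exp_quo_transfer (N := N) hκ.le (u - t) u x').trans ?_) hA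
        refine mul_le_mul_of_nonneg_right (Real.exp_le_exp.mpr ?_) (Real.exp_pos _).le
        rw [l1_sub_sub_self]
        have := hCRl1 t ht
        have hκ' := hκ.le
        gcongr
      have hR : |Rg (u - (s + t)) l'| ≤ A * Real.exp (κ * (3 * D * R / N + D)) * Real.exp (-κ * l1 (quo N u - z')) := by
        refine (hRg (u - (s + t)) l').trans ?_
        rw [mul_assoc]
        refine mul_le_mul_of_nonneg_left ((exp_quo_transfer (N := N) hκ.le (u - (s + t)) u z').trans ?_) hA
        refine mul_le_mul_of_nonneg_right (Real.exp_le_exp.mpr ?_) (Real.exp_pos _).le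
        rw [l1_sub_sub_self]
        have h3 : l1 (s + t) ≤ 3 * D * R := by
          have := l1_add_le s t; have := hC2l1 s hs; have := hCRl1 t ht; push_cast at *; nlinarith
        have hκ' := hκ.le
        gcongr
      have hHu := hH k u
      calc |Lg (u - t) l| * (c * (|H k u| * |Q k u (u - t) (u - (s + t)) l l'|)) * |Rg (u - (s + t)) l'|
          ≤ (A * Real.exp (κ * (D * R / N + D)) * Real.exp (-κ * l1 (quo N u - x')))
              * (c * ((A * Real.exp (-κ * l1 (quo N u - u'))) * |Q k u (u - t) (u - (s + t)) l l'|))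
              * (A * Real.exp (κ * (3 * D * R / N + D)) * Real.exp (-κ * l1 (quo N u - z'))) := by
            gcongr
        _ = K₀ * (c * E3 u) * |Q k u (u - t) (u - (s + t)) l l'| := by
            rw [hK₀, hE3]
            simp only
            rw [show κ * (4 * D * R / N + 2 * D) = κ * (D * R / N + D) + κ * (3 * D * R / N + D) by ring, Real.exp_add,
              show -κ * (l1 (quo N u - x') + l1 (quo N u - u') + l1 (quo N u - z'))
                = -κ * l1 (quo N u - x') + -κ * l1 (quo N u - u') + -κ * l1 (quo N u - z') by ring,
              Real.exp_add, Real.exp_add]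
            ring
  -- STEP 6: the table's two-leg mass, jointly in the two offsets
  have step6 : ∀ (u : Fin D → ℤ) k l l', ∑ s ∈ C2, ∑ t ∈ CR, |Q k u (u - t) (u - (s + t)) l l'| ≤ mP := by
    intro u k l l'
    rw [← Finset.sum_product']
    have hinj : Set.InjOn (fun p : (Fin D → ℤ) × (Fin D → ℤ) => (u - p.2, u - (p.1 + p.2))) ↑(C2 ×ˢ CR) := by
      intro p _ q _ h
      simp only [Prod.mk.injEq] at h
      obtain ⟨h1, h2⟩ := h
      have ht : p.2 = q.2 := sub_right_injective h1
      have hst : p.1 + p.2 = q.1 + q.2 := sub_right_injective h2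
      have hs' : p.1 = q.1 := by rw [ht] at hst; exact add_right_cancel hst
      exact Prod.ext hs' ht
    have hsub : (C2 ×ˢ CR).image (fun p : (Fin D → ℤ) × (Fin D → ℤ) => (u - p.2, u - (p.1 + p.2)))
        ⊆ (CR.image fun t => u - t) ×ˢ (C3.image fun r => u - r) := by
      intro q hq
      rw [Finset.mem_image] at hq
      obtain ⟨p, hp, rfl⟩ := hq
      rw [Finset.mem_product] at hp ⊢
      refine ⟨Finset.mem_image.mpr ⟨p.2, hp.2, rfl⟩, Finset.mem_image.mpr ⟨p.1 + p.2, ?_, rfl⟩⟩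
      rw [hC3, Fintype.mem_piFinset]
      intro i
      have h1 := Fintype.mem_piFinset.mp hp.1 i
      have h2 := Fintype.mem_piFinset.mp hp.2 i
      rw [Finset.mem_Icc] at h1 h2 ⊢
      simp only [Pi.add_apply]
      push_cast at h1 h2 ⊢
      omega
    calc ∑ p ∈ C2 ×ˢ CR, |Q k u (u - p.2) (u - (p.1 + p.2)) l l'|
        = ∑ q ∈ (C2 ×ˢ CR).image (fun p : (Fin D → ℤ) × (Fin D → ℤ) => (u - p.2, u - (p.1 + p.2))), |Q k u q.1 q.2 l l'| :=
          (Finset.sum_image (f := fun q : (Fin D → ℤ) × (Fin D → ℤ) => |Q k u q.1 q.2 l l'|) hinj).symm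
      _ ≤ ∑ q ∈ (CR.image fun t => u - t) ×ˢ (C3.image fun r => u - r), |Q k u q.1 q.2 l l'| :=
          Finset.sum_le_sum_of_subset_of_nonneg hsub (fun _ _ _ => abs_nonneg _)
      _ = ∑ w ∈ CR.image (fun t => u - t), ∑ y ∈ C3.image (fun r => u - r), |Q k u w y l l'| := by
          rw [Finset.sum_product]
      _ ≤ mP := hM k u l l' _ _
  -- STEP 7: assemble
  have hterm : ∀ l' l k s t, Summable (fun u => K₀ * (c * E3 u) * |Q k u (u - t) (u - (s + t)) l l'|) := by
    intro l' l k s t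
    refine summable_of_abs_le (((summable_blockSum_exp (N := N) hκ x' u' z').mul_left K₀).mul_right mP) (fun u => ?_)
    rw [abs_of_nonneg (by positivity)]
    exact mul_le_mul_of_nonneg_left (hQle _ _ _ _ _ _) (by positivity)
  calc |∑' y, ∑ l', (∑' w, ∑ l, Lg w l * ∑ k, c * ∑' u, H k u * Q k u w y l l') * Rg y l'|
      ≤ ∑ l', ∑ l, ∑ k, ∑ s ∈ C2, ∑ t ∈ CR, ∑' y, T l' l k s t y := step4
    _ ≤ ∑ l', ∑ l, ∑ k, ∑ s ∈ C2, ∑ t ∈ CR, ∑' u, K₀ * (c * E3 u) * |Q k u (u - t) (u - (s + t)) l l'| :=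
        Finset.sum_le_sum fun l' _ => Finset.sum_le_sum fun l _ => Finset.sum_le_sum fun k _ =>
          Finset.sum_le_sum fun s hs => Finset.sum_le_sum fun t ht => step5 l' l k s hs t ht
    _ = ∑' u, ∑ l', ∑ l, ∑ k, ∑ s ∈ C2, ∑ t ∈ CR, K₀ * (c * E3 u) * |Q k u (u - t) (u - (s + t)) l l'| :=
        (tsum_sum₅ _ _ _ _ _ (fun l' _ l _ k _ s _ t _ => hterm l' l k s t)).symm
    _ = ∑' u, K₀ * (c * E3 u) * ∑ l', ∑ l, ∑ k, ∑ s ∈ C2, ∑ t ∈ CR, |Q k u (u - t) (u - (s + t)) l l'| := by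
        refine tsum_congr fun u => ?_
        simp only [Finset.mul_sum]
    _ ≤ ∑' u, K₀ * (c * E3 u) * ((Fintype.card ι : ℝ) ^ 3 * mP) := by
        have hmaj : Summable (fun u => K₀ * (c * E3 u) * ((Fintype.card ι : ℝ) ^ 3 * mP)) :=
          ((summable_blockSum_exp (N := N) hκ x' u' z').mul_left K₀).mul_right _
        refine abs_le.mp (abs_tsum_le_of_le hmaj (fun u => ?_)) |>.2
        rw [abs_of_nonneg (mul_nonneg (by positivity) (Finset.sum_nonneg fun _ _ => Finset.sum_nonneg fun _ _ =>
          Finset.sum_nonneg fun _ _ => Finset.sum_nonneg fun _ _ => Finset.sum_nonneg fun _ _ => abs_nonneg _))]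
        refine mul_le_mul_of_nonneg_left ?_ (by positivity)
        calc ∑ l', ∑ l, ∑ k, ∑ s ∈ C2, ∑ t ∈ CR, |Q k u (u - t) (u - (s + t)) l l'|
            ≤ ∑ _l' : ι, ∑ _l : ι, ∑ _k : ι, mP :=
              Finset.sum_le_sum fun l' _ => Finset.sum_le_sum fun l _ => Finset.sum_le_sum fun k _ => step6 u k l l'
          _ = (Fintype.card ι : ℝ) ^ 3 * mP := by
              simp only [Finset.sum_const, Finset.card_univ, nsmul_eq_mul]; ring
    _ = K₀ * ((Fintype.card ι : ℝ) ^ 3 * mP) * ∑' u, c * E3 u := by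
        rw [← tsum_mul_left]; exact tsum_congr fun u => by ring
    _ ≤ K₀ * ((Fintype.card ι : ℝ) ^ 3 * mP) * (Zl D (κ / 2) * Real.exp (-(κ / 2) * (l1 (x' - u') + l1 (z' - u')))) :=
        mul_le_mul_of_nonneg_left (blockSum_exp_le (N := N) hκ x' u' z') (by positivity)
    _ = (Fintype.card ι : ℝ) ^ 3 * A ^ 3 * Real.exp (κ * (4 * D * R / N + 2 * D)) * mP * Zl D (κ / 2)
          * Real.exp (-(κ / 2) * (l1 (x' - u') + l1 (z' - u'))) := by rw [hK₀]; ring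

/-! ## §4 The two-channel bound -/
/-- **THE GENERIC TWO-CHANNEL UNIT-SANDWICH BOUND** («VH3»): the literal bracket of `E3UnitSplitLevels.e3VH_unit_split_of` with ABSTRACT
legs — `Φx w l` (the `mm` leg from `N•x′`, bound `A·e^{−κ|x′ − quo_N w|₁}`), `Gx w l` (`G̃`, bound `A·e^{−κ|quo_N w − x′|₁}`), `H k u` (`H̃` to
the source `u′`), `Hz y l′`, `Φz y l′` (legs to `z′`) — and ABSTRACT off-diagonal tables `P₁` (channel `(inr, inl)`) ∕ `P₂` (channel
`(inl, inr)`) with `ℓ¹`-support radius `R` around the vertex location and two-leg mass `≤ mP` over any finite sets, the vertex location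
summed as the block average `N^{−D}Σ'_u`:  `|sandwich| ≤ 2·(#ι)³·A³·e^{κ(4DR/N + 2D)}·mP·Zl_D(κ/2)·e^{−(κ/2)(|x′−u′|₁ + |z′−u′|₁)}` —
`N` enters only through `R/N`. [folklore] -/
theorem abs_twoChannel_le {N : ℕ} [NeZero N] {ι : Type*} [Fintype ι]
    (Φx Gx : (Fin D → ℤ) → ι → ℝ) (H : ι → (Fin D → ℤ) → ℝ) (Hz Φz : (Fin D → ℤ) → ι → ℝ)
    (P₁ P₂ : ι → (Fin D → ℤ) → (Fin D → ℤ) → (Fin D → ℤ) → ι → ι → ℝ)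
    {x' u' z' : Fin D → ℤ} {A κ mP : ℝ} {R : ℕ} (hκ : 0 < κ) (hA : 0 ≤ A) (hmP : 0 ≤ mP)
    (hΦx : ∀ w l, |Φx w l| ≤ A * Real.exp (-κ * l1 (x' - quo N w)))
    (hGx : ∀ w l, |Gx w l| ≤ A * Real.exp (-κ * l1 (quo N w - x')))
    (hH : ∀ k u, |H k u| ≤ A * Real.exp (-κ * l1 (quo N u - u')))
    (hHz : ∀ y l, |Hz y l| ≤ A * Real.exp (-κ * l1 (quo N y - z')))
    (hΦz : ∀ y l, |Φz y l| ≤ A * Real.exp (-κ * l1 (quo N y - z')))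
    (hS₁ : ∀ k u w y l l', P₁ k u w y l l' ≠ 0 → l1 (w - u) ≤ R ∧ l1 (y - u) ≤ R)
    (hS₂ : ∀ k u w y l l', P₂ k u w y l l' ≠ 0 → l1 (w - u) ≤ R ∧ l1 (y - u) ≤ R)
    (hM₁ : ∀ k u l l' (S T : Finset (Fin D → ℤ)), ∑ w ∈ S, ∑ y ∈ T, |P₁ k u w y l l'| ≤ mP)
    (hM₂ : ∀ k u l l' (S T : Finset (Fin D → ℤ)), ∑ w ∈ S, ∑ y ∈ T, |P₂ k u w y l l'| ≤ mP) :
    |∑' y, ((∑ l', (∑' w, ∑ l, Φx w l * ∑ k, ((N : ℝ) ^ D)⁻¹ * ∑' u, H k u * P₁ k u w y l l') * Hz y l') +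
        ∑ l', (∑' w, ∑ l, Gx w l * ∑ k, ((N : ℝ) ^ D)⁻¹ * ∑' u, H k u * P₂ k u w y l l') * Φz y l')|
      ≤ 2 * ((Fintype.card ι : ℝ) ^ 3 * A ^ 3 * Real.exp (κ * (4 * D * R / N + 2 * D)) * mP * Zl D (κ / 2)
          * Real.exp (-(κ / 2) * (l1 (x' - u') + l1 (z' - u')))) := by
  have hΦx' : ∀ w l, |Φx w l| ≤ A * Real.exp (-κ * l1 (quo N w - x')) := fun w l => by
    rw [l1_sub_symm]; exact hΦx w l
  obtain ⟨hs₁, hb₁⟩ := channel_bound Φx H Hz P₁ hκ hA hmP hΦx' hH hHz hS₁ hM₁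
  obtain ⟨hs₂, hb₂⟩ := channel_bound Gx H Φz P₂ hκ hA hmP hGx hH hΦz hS₂ hM₂
  rw [hs₁.tsum_add hs₂]
  refine (abs_add_le _ _).trans ?_
  linarith

end Summit.QuantumFields.BalabanUV.Beta.GAN24.TaylorVHSandwich

end
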